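import Literature.Barriers.AtomisticToContinuum.TetrahedralFrustrationKeplerProofs
import Literature.Geometry.DiscreteGeometry.KissingPatterns
import Mathlib.Topology.MetricSpace.Isometry
import HarnessLib

/-!
# The Hales–Ferguson score: finite-dimensional reduction, local optimality and its equality case
(topic `Literature/Geometry/DiscreteGeometry`; serves route `AtomisticToContinuum/CornerKeplerStability`,
items `StableKeplerCounting`, `UniformKeplerCounting`)

**Source (held and read).**  T. C. Hales, S. P. Ferguson, *A formulation of the Kepler
conjecture*, Discrete Comput. Geom. 36 (2006), 21–69, as reprinted in *The Kepler Conjecture.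
The Hales–Ferguson proof* (J. C. Lagarias, ed., Springer 2011), §3 "The top-level structure of
the proof", §6 "Decomposition stars", §7 "Scoring" [HalesFerguson2006]; the same §1 material in
Hales, *A proof of the Kepler conjecture*, Ann. of Math. 162 (2005) = arXiv:math/9811078, §1
(Lemma 1.2, Remark 1.3, Conjecture 1.4, Lemma 1.5, Theorems 1.6–1.7) [Hales1998]; errata and
the 2009 revision: Hales–Harrison–McLaughlin–Nipkow–Obua–Zumkeller, *A revision of the proof of
the Kepler conjecture*, DCG 44 (2010), Part 2 (same volume) [HalesEtAl2010].  Conventions of the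
source and of the tree's `FejesTothKissingTwelve` / `TetrahedralFrustration`: balls of radius `1`,
a packing `Λ` is its set of centres, pairwise at distance `≥ 2`
(`Literature.Geometry.DiscreteGeometry.IsUnitBallPacking`), *saturated*
(`Literature.Barriers.AtomisticToContinuum.IsSaturated`); `Ω(v)` is the Voronoi cell
(`Literature.Barriers.AtomisticToContinuum.voronoiCell`); `pt`, `δ_oct` are the tree's
`halesPoint`, `octahedronDensity` (closed forms equal to the printed ones, see below);
`t₀ = 1.255`, `2t₀ = 2.51`.

**What is printed** (book pagination of the reprint; DCG numbering).

* Def. 3.2: `A : Λ → ℝ` is *negligible* if "there is a constant `C₁` such that for all `r ≥ 1`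
  and all `x ∈ ℝ³`, `∑_{v ∈ Λ(x,r)} A(v) ≤ C₁ r²`" (`Λ(x, r) = Λ ∩ B(x, r)`, `B` the CLOSED ball);
  *fcc-compatible* if `√32 ≤ vol Ω(v) + A(v)` for all `v`.  Lemma 3.3 (= Hales1998 Lemma 1.2):
  negligible + fcc-compatible ⇒ `δ(x, r, Λ) ≤ π/√18 + C/r`, "The constant `C` depends on `Λ` only
  through the constant `C₁`" (PROVED in the tree, blueprint form:
  `Literature.Barriers.AtomisticToContinuum.kepler_bound_of_negligible_fccCompatible`).
* §3, after Remark 3.4: "Section 6 defines a compact topological space DS (the space of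
  decomposition stars, Definition 6.2) and a continuous function `σ` on that space … If `Λ` is a
  saturated packing, then there is a geometric object `D(v, Λ)` constructed around each vertex
  `v ∈ Λ`.  `D(v, Λ)` depends on `Λ` only through the vertices in `Λ` that are at most a
  constant distance away from `v`.  That constant is independent of `v` and `Λ`" (it is
  `d₀ = 2√2 + 4√3`, §6.1); "`vol Ω(v) = vol Ω(D(v, Λ))`"; "The topological space DS embeds into
  a finite-dimensional Euclidean space."
* Thm. 3.5 (= Thm. 7.11): for each saturated `Λ` the function `A(v) = A₀(D(v, Λ))` is
  negligible for `Λ`.  (3.4) / Def. 7.12: `σ(D) = -4δ_oct (vol Ω(D) + A₀(D)) + 16π/3`, so that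
  `A(v) = (16π/3 - σ(D(v, Λ)))/(4δ_oct) - vol Ω(v)`.  Def. 3.6: `pt = 4 arctan(√2/5) - π/3 =
  √2 δ_tet - π/3 = -2(√2 δ_oct - π/3)`; `π/√18 = δ_tet/3 + 2δ_oct/3`, `δ_tet = √8 arctan(√2/5)`.
* **Thm. 3.7** (= Hales1998 Thm. 1.6, finite-dimensional reduction): "The maximum of `σ` on the
  topological space DS of all decomposition stars is the constant `8 pt ≈ 0.442989`."
* "Let `U(v, Λ)` be the set of vertices in `Λ` at nonzero distance at most `2t₀` from `v`.  From
  `v` and a decomposition star `D(v, Λ)` it is possible to recover `U(v, Λ)`, which we write as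
  `U(D)`."  **Thm. 3.9** (= Hales1998 Thm. 1.7, the equality case): "Let `D` be a decomposition
  star at which the function `σ : DS → ℝ` attains its maximum.  Then the set `U(D)` of vectors at
  distance at most `2t₀` from the center has cardinality twelve.  Up to Euclidean motion, `U(D)`
  is one of two arrangements: the kissing arrangement of the twelve balls around a central ball
  in the fcc packing or the kissing arrangement of twelve balls in the hcp."
* Def. 6.1–6.2 (the topology): a decomposition star is an orbit `[f, t]`, `f : T' → B(0, d₀)`
  the translated coordinates `vᵢ - v` of the vertices within `d₀` of `v`, `t` the tuple of
  finite indexing sets (`I'₂` = pairs at distance `≤ 2t₀`, …); "we take the topology to be that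
  inherited from the standard topology on `B(0, d₀)` and the discrete topology on the finite
  indexing sets"; DS is the compactification of DS° "obtained by replacing open conditions by
  closed conditions"; "Compactness comes from the compactness of the closed ball `B(0, d₀)`, the
  closed conditions on indexing sets, and the finiteness of `T'`."
* Errata check (requested by the item): the 2010 revision's errata listing (§9.1) begins at
  p. 47 of the DCG text and touches nothing in §3; the gap it fills (§8, biconnectedness of the
  graphs bounding standard regions) is internal to the proof.  Theorems 3.7 and 3.9 stand as
  printed.  Ferguson's Paper V enters §3 only as Thm. 3.10 (no contravening star with graph
  `G_pent`).

**Rendering (the named fact `HalesFerguson_scoreEquality`).**  The work item asks for the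
statement "over an abstract interface (decomposition stars need not be constructed)".  The
fact therefore asserts the EXISTENCE of the printed structure — a compact Hausdorff space `X`
(DS), a continuous `σ : X → ℝ`, the finite set `U(D) ⊂ ℝ³` attached to each `D ∈ X`, and the
assignment `(Λ, v) ↦ D(v, Λ)` — with exactly the printed properties listed above: continuity
of `σ`; the Def. 6.1 topology on the part of the data the route uses, namely that `D ↦ U(D)` is
continuous for the matching distance (`Literature.Geometry.DiscreteGeometry.EtaMatched`: nearby
stars have equinumerous `U`'s matched point by point within `η`) — this is the sentence "the
standard topology on `B(0, d₀)` and the discrete topology on the finite indexing sets" read on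
the `I'₂`-labelled coordinates; Thm. 3.7 (`σ ≤ 8 pt`, attained); Thm. 3.9 verbatim (Euclidean
motion = `IsometryEquiv` of `ℝ³`; the kissing arrangements are `2 •` the unit-vector patterns
`fccKissingPattern`, `hcpKissingPattern` of `KissingPatterns.lean`); the locality of `D(v, Λ)`;
`U(D(v, Λ)) = U(v, Λ) - v`; and the negligibility of
`A(v) = (16π/3 - σ(D(v, Λ)))/(4δ_oct) - vol Ω(v)` for every saturated packing, with the
constant `C₁` quantified AS PRINTED, per packing (Def. 3.2 / Thm. 3.5).  On the last point the
item asked to "record what is printed" about the universality of `C₁`: the STATEMENTS (Def. 3.2,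
Thm. 3.5 = Thm. 7.11) are per packing; the PROOF of Thm. 7.11 (§7.2) produces two constants that
are visibly independent of `Λ` — `vol B(x, r + 2√3) - vol B(x, r - 2) ≤ C₁' r²` and the number
of quarters of the `Q`-system meeting the shell of width `2√8` about `∂B(x, r)` (at most a
universal multiple of `r²` for a `2`-separated set) times a bound for the correction `A₁` on the
compact DS — and Lemma 3.3 is careful to say that `C` depends on `Λ` only through `C₁`; but no
universal constant is asserted in print, so none is vendored here (D-0014: never stronger than
the source).  A consumer needing `C₁` uniform over packings must file that strengthening as its
own item, pointing at the proof of Thm. 7.11.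

**Proved here.**  `eight_halesPoint_eq` (`8 pt = -4δ_oct √32 + 16π/3`, the identity in the
proof of Lemma 7.13), `sqrt32_eq_correctedVolume_const` (Lemma 1.5: `-8pt/(4δ_oct) + 4π/(3δ_oct)
= √32`), `correctedVolume_eq_surplus` (the affine identity behind the route's "surplus" reading:
`vol Ω(v) + A(v) = √32 + (8 pt - σ(D(v,Λ)))/(4δ_oct)`), and the wiring check
`Hales_kepler_of_scoreEquality`: the fact implies the tree's named Kepler fact
`Literature.Barriers.AtomisticToContinuum.Hales_kepler` through the tree's proved Lemma 3.3 /
DSP Lemma 6.13 — i.e. "Theorem 3.7, Lemma 7.13 and Lemma 3.3 combine to give a proof of the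
Kepler conjecture" (§3) holds formally for the vendored package (signs, units and constants are
thereby pinned).

## Mathlib / tree search

Reused, not restated (`lean search`): `IsUnitBallPacking` (`FejesTothKissingTwelve`),
`IsSaturated`, `voronoiCell`, `halesPoint`, `octahedronDensity`, `Hales_kepler`, `IsNegligible`,
`IsFccCompatible`, `Hales_kepler_of_negligibleFccCompatible`, `volume_voronoiCell_lt_top`,
`finite_inter_ball_of_packing`, `arccos_inv_sqrt_three`, `sqrt_eight_eq_two_mul_sqrt_two`
(`Literature/Barriers/AtomisticToContinuum/TetrahedralFrustration*`), `fccKissingPattern`,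
`hcpKissingPattern`, `EtaMatched` (`KissingPatterns`).  Mathlib: `IsometryEquiv`, `finsum`,
`IsCompact.exists_isMinOn`.  No decomposition stars, scores or Hales–Ferguson statements exist in
the tree (`lean search 'decomposition|scoreEquality|HalesFerguson'`: nothing); exactly one new
named fact is introduced and no definition.

## References

* T. C. Hales, S. P. Ferguson, *A formulation of the Kepler conjecture*, Discrete Comput. Geom.
  36 (2006), 21–69; reprinted in *The Kepler Conjecture* (Springer, 2011), 83–133: Def. 3.2,
  Lemma 3.3, Remark 3.4, Thm. 3.5, (3.4), Def. 3.6, Thm. 3.7, Thm. 3.9, Def. 6.1–6.3,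
  Lemma 7.9, Thm. 7.11, Def. 7.12, Lemma 7.13. [HalesFerguson2006]
* T. C. Hales, *A proof of the Kepler conjecture*, Ann. of Math. 162 (2005), 1065–1185
  (arXiv:math/9811078), §1: Lemma 1.2, Remark 1.3, Lemma 1.5, Thm. 1.6, Thm. 1.7. [Hales1998]
* T. C. Hales et al., *A revision of the proof of the Kepler conjecture*, Discrete Comput.
  Geom. 44 (2010), 1–34, §§8–9. [HalesEtAl2010]
* T. C. Hales, *Dense Sphere Packings* (2012), Def. 6.11, Lemma 6.13. [HalesDSP2012]
-/

noncomputable section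

open scoped Topology
open Real MeasureTheory Metric Filter Set
open Literature.Barriers.AtomisticToContinuum

namespace Literature.Geometry.DiscreteGeometry


/-! ### The constants: `8 pt = -4 δ_oct √32 + 16π/3` -/

/-- `√32 = 4√2`. [folklore] -/
theorem sqrt_thirtyTwo : √32 = 4 * √2 := by
  rw [show (32 : ℝ) = 4 ^ 2 * 2 by norm_num, Real.sqrt_mul (by norm_num),
    Real.sqrt_sq (by norm_num)]

/-- **The identity in the proof of Lemma 7.13**: `8 pt = -4 δ_oct √32 + 16π/3` ("Note that this
identity is parallel in form to Definition 7.12 for `σ`"), for the tree's closed forms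
`pt = 11π/3 - 12 arccos(1/√3)`, `δ_oct = (-3π + 12 arccos(1/√3))/√8`.
[cite: HalesFerguson2006, Lemma 7.13 (proof)] -/
theorem eight_halesPoint_eq :
    8 * halesPoint = -4 * octahedronDensity * √32 + 16 * π / 3 := by
  unfold halesPoint octahedronDensity
  rw [sqrt_thirtyTwo, sqrt_eight_eq_two_mul_sqrt_two]
  have h2 : √2 ≠ 0 := by positivity
  rw [show -4 * ((-3 * π + 12 * arccos (1 / √3)) / (2 * √2)) * (4 * √2)
      = -8 * (-3 * π + 12 * arccos (1 / √3)) by field_simp; ring]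
  ring

/-- `δ_oct > 0`. [folklore] -/
theorem octahedronDensity_pos : 0 < octahedronDensity := by
  have := octahedronDensity_bounds.1; linarith

/-- **Lemma 1.5's evaluation**: `-8 pt/(4 δ_oct) + 4π/(3 δ_oct) = √32` ("The left-hand side of
this inequality evaluates to `√32`"). [cite: Hales1998, Lemma 1.5 (proof)] -/
theorem sqrt32_eq_correctedVolume_const :
    -(8 * halesPoint) / (4 * octahedronDensity) + 4 * π / (3 * octahedronDensity) = √32 := by
  have hδ := octahedronDensity_pos
  rw [eight_halesPoint_eq]
  field_simp
  ring

/-- **The affine "surplus" identity** (Lemma 1.5 / Lemma 7.13 read with a surplus, as the route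
`CornerKeplerStability` uses it): with `A(v) = (16π/3 - σ)/(4 δ_oct) - vol Ω(v)` one has
`vol Ω(v) + A(v) = √32 + (8 pt - σ)/(4 δ_oct)`; in particular `σ ≤ 8 pt` is exactly
fcc-compatibility `√32 ≤ vol Ω(v) + A(v)`. [cite: Hales1998, Lemma 1.5 (proof)] -/
theorem correctedVolume_eq_surplus (s vvol : ℝ) :
    vvol + ((16 * π / 3 - s) / (4 * octahedronDensity) - vvol) =
      √32 + (8 * halesPoint - s) / (4 * octahedronDensity) := by
  have hδ := octahedronDensity_pos
  rw [← sqrt32_eq_correctedVolume_const]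
  field_simp
  ring

/-! ### The named fact -/

/-- **Hales–Ferguson: the score on the space of decomposition stars, its maximum `8 pt` and the
equality case** (Hales–Ferguson, *A formulation of the Kepler conjecture*, DCG 36 (2006), §3:
Def. 3.2, Thm. 3.5, (3.4), Thm. 3.7, Thm. 3.9, with Def. 6.1–6.2 and Thm. 7.11 / Def. 7.12; =
Hales, Ann. of Math. 162 (2005), §1, Lemma 1.5, Thms. 1.6–1.7).  Over an abstract interface
(module docstring, *Rendering*): there exist a compact Hausdorff space `X` (the space DS of
decomposition stars, Def. 6.2; "DS embeds into a finite-dimensional Euclidean space"), a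
continuous score `σ : X → ℝ`, a finite set `U(D) ⊂ ℝ³` for each `D ∈ X`, and for saturated
packings `Λ` of unit balls an assignment `v ↦ D(v, Λ) ∈ X`, such that:
(i) `D ↦ U(D)` is continuous for the matching distance (Def. 6.1: Euclidean topology on the
coordinates, discrete on the indexing sets — nearby stars have their `U`'s matched point by
point within any `η > 0`);
(ii) Thm. 3.7: `σ(D) ≤ 8 pt` for all `D`, with equality attained;
(iii) Thm. 3.9: if `σ(D) = 8 pt` then `U(D)` has twelve elements and, up to a Euclidean motion
of `ℝ³`, is the fcc or the hcp kissing arrangement (`2 •` the cuboctahedron `fccKissingPattern`,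
resp. the anticuboctahedron `hcpKissingPattern`, of `KissingPatterns.lean`);
(iv) locality: for some `d` (`= 2√2 + 4√3`, §6.1), `D(v, Λ)` depends on `Λ` only through
`Λ ∩ B(v, d)`;
(v) `U(D(v, Λ)) = {w - v : w ∈ Λ, 0 < |w - v| ≤ 2t₀ = 2.51}`;
(vi) Thm. 3.5 (= Thm. 7.11, with Def. 7.12 and `vol Ω(D(v, Λ)) = vol Ω(v)`): for every
saturated packing `Λ` the function `A(v) = (16π/3 - σ(D(v, Λ)))/(4 δ_oct) - vol Ω(v)` is
negligible — there is `C₁` (quantified per packing, as printed; module docstring) with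
`∑_{v ∈ Λ ∩ B(x, r)} A(v) ≤ C₁ r²` for all `x` and all `r ≥ 1` (`B` closed).
Errata (DCG 44 (2010), §9.1): none affects §3.  The package implies the tree's Kepler fact
(`Hales_kepler_of_scoreEquality`, proved).
[cite: HalesFerguson2006, §3 Thm. 3.7 and Thm. 3.9; Def. 3.2, Thm. 3.5, Def. 6.1–6.2, Thm. 7.11, Def. 7.12]
[cite: Hales1998, §1 Thm. 1.6, Thm. 1.7, Lemma 1.5, Remark 1.3] [cite: HalesEtAl2010, §9.1] -/
def HalesFerguson_scoreEquality : Prop :=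
  ∃ (X : Type) (_ : TopologicalSpace X) (_ : CompactSpace X) (_ : T2Space X)
    (σ : X → ℝ) (U : X → Finset (EuclideanSpace ℝ (Fin 3)))
    (D : Set (EuclideanSpace ℝ (Fin 3)) → EuclideanSpace ℝ (Fin 3) → X),
    -- the score is continuous on DS (§3; Lemma 7.9 with Def. 7.12)
    Continuous σ ∧
    -- (i) Def. 6.1: `D ↦ U(D)` is continuous for the matching distance
    (∀ (D₀ : X) (η : ℝ), 0 < η → ∀ᶠ D' in 𝓝 D₀, EtaMatched η (U D') (U D₀)) ∧
    -- (ii) Thm. 3.7: the maximum of `σ` on DS is `8 pt`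
    (∀ D' : X, σ D' ≤ 8 * halesPoint) ∧ (∃ D' : X, σ D' = 8 * halesPoint) ∧
    -- (iii) Thm. 3.9: the equality case
    (∀ D' : X, σ D' = 8 * halesPoint → (U D').card = 12 ∧
      ∃ g : EuclideanSpace ℝ (Fin 3) ≃ᵢ EuclideanSpace ℝ (Fin 3),
        g '' ((fun p : EuclideanSpace ℝ (Fin 3) => (2 : ℝ) • p) '' ↑fccKissingPattern) =
            ↑(U D') ∨
          g '' ((fun p : EuclideanSpace ℝ (Fin 3) => (2 : ℝ) • p) '' ↑hcpKissingPattern) =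
            ↑(U D')) ∧
    -- (iv) locality of `D(v, Λ)` (§3; `d₀ = 2√2 + 4√3`, §6.1)
    (∃ d : ℝ, ∀ Λ Λ' : Set (EuclideanSpace ℝ (Fin 3)), IsUnitBallPacking Λ →
      IsSaturated Λ → IsUnitBallPacking Λ' → IsSaturated Λ' →
      ∀ v : EuclideanSpace ℝ (Fin 3), v ∈ Λ → v ∈ Λ' →
        Λ ∩ closedBall v d = Λ' ∩ closedBall v d → D Λ v = D Λ' v) ∧
    -- (v) `U(D(v, Λ))` and (vi) Thm. 3.5 / 7.11: negligibility, for every saturated packing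
    (∀ Λ : Set (EuclideanSpace ℝ (Fin 3)), IsUnitBallPacking Λ → IsSaturated Λ →
      (∀ v ∈ Λ, (↑(U (D Λ v)) : Set (EuclideanSpace ℝ (Fin 3))) =
          (fun w : EuclideanSpace ℝ (Fin 3) => w - v) ''
            {w | w ∈ Λ ∧ w ≠ v ∧ dist w v ≤ 2.51}) ∧
      ∃ C₁ : ℝ, ∀ (x : EuclideanSpace ℝ (Fin 3)) (r : ℝ), 1 ≤ r →
        ∑ᶠ v ∈ Λ ∩ closedBall x r,
            ((16 * π / 3 - σ (D Λ v)) / (4 * octahedronDensity) -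
              (volume (voronoiCell Λ v)).toReal) ≤ C₁ * r ^ 2)

/-! ### Wiring check: the package implies the Kepler fact of the tree -/

/-- **"Theorem 3.7, Lemma 7.13 and Lemma 3.3 combine to give a proof of the Kepler conjecture"**
(HalesFerguson2006 §3; Hales1998 §1: "Theorem 1.6, Lemma 1.5, and Lemma 1.2 combine …"), for
the vendored package: `HalesFerguson_scoreEquality` implies the tree's named fact
`Literature.Barriers.AtomisticToContinuum.Hales_kepler` (Kepler's theorem in Hales's precise
sense).  Proof: for a saturated packing `Λ`, the function `A` of clause (vi) is negligible in the
blueprint sense (`IsNegligible`: open balls about `0` — an open ball meets `Λ` in `Λ ∩ B̄(0, r')`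
with `r'` the largest norm present; for `r' < 1` the finitely many terms are bounded using
`min σ` on the compact `X`) and fcc-compatible by (ii) and `correctedVolume_eq_surplus`; then the
tree's proved Lemma 3.3 / DSP Lemma 6.13 (`Hales_kepler_of_negligibleFccCompatible`) applies.
[cite: HalesFerguson2006, §3 (after Thm. 3.7)] [cite: HalesDSP2012, Lemma 6.13, Remark 6.16] -/
theorem Hales_kepler_of_scoreEquality (h : HalesFerguson_scoreEquality) : Hales_kepler := by
  obtain ⟨X, _, _, _, σ, U, D, hσ, -, hle, ⟨Dmax, hDmax⟩, -, -, hpack⟩ := h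
  refine Hales_kepler_of_negligibleFccCompatible fun Λ hΛ hsat => ?_
  obtain ⟨-, C₁, hC₁⟩ := hpack Λ hΛ hsat
  have hδ := octahedronDensity_pos
  -- the function `A` of Thm. 3.5
  set A : EuclideanSpace ℝ (Fin 3) → ℝ := fun v =>
    (16 * π / 3 - σ (D Λ v)) / (4 * octahedronDensity) - (volume (voronoiCell Λ v)).toReal
    with hA
  -- `σ` is bounded below on the compact `X`, hence `A` is bounded above
  obtain ⟨x₀, -, hx₀⟩ :=
    isCompact_univ.exists_isMinOn (⟨Dmax, mem_univ _⟩ : (univ : Set X).Nonempty)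
      hσ.continuousOn
  set M : ℝ := (16 * π / 3 - σ x₀) / (4 * octahedronDensity) with hM
  have hAle : ∀ v, A v ≤ M := fun v => by
    have h1 : σ x₀ ≤ σ (D Λ v) := hx₀ (mem_univ _)
    have h2 : (0 : ℝ) ≤ (volume (voronoiCell Λ v)).toReal := ENNReal.toReal_nonneg
    have h3 : (16 * π / 3 - σ (D Λ v)) / (4 * octahedronDensity) ≤ M :=
      div_le_div_of_nonneg_right (by linarith) (by positivity)
    simp only [hA]
    linarith
  refine ⟨A, ?_, ?_⟩
  · -- negligibility in the blueprint sense (open balls about the origin)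
    have hfin1 : (Λ ∩ closedBall (0 : EuclideanSpace ℝ (Fin 3)) 1).Finite :=
      (finite_inter_ball_of_packing hΛ 0 2).subset
        (inter_subset_inter_right _ (closedBall_subset_ball (by norm_num)))
    set N : ℕ := hfin1.toFinset.card with hN
    refine ⟨max C₁ 0 + N * max M 0, fun r hr => ?_⟩
    have hfin : (Λ ∩ ball (0 : EuclideanSpace ℝ (Fin 3)) r).Finite :=
      finite_inter_ball_of_packing hΛ 0 r
    rw [finsum_mem_eq_finite_toFinset_sum _ hfin]
    have hc0 : 0 ≤ max C₁ 0 + N * max M 0 := by positivity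
    by_cases hne : hfin.toFinset.Nonempty
    · -- `r'` = the largest norm of a vertex in the open ball
      set r' : ℝ := hfin.toFinset.sup' hne (fun v => ‖v‖) with hr'
      have hr'lt : r' < r := by
        refine (Finset.sup'_lt_iff hne).mpr fun v hv => ?_
        have := (hfin.mem_toFinset.mp hv).2
        rwa [mem_ball_zero_iff] at this
      have hset : Λ ∩ closedBall (0 : EuclideanSpace ℝ (Fin 3)) r' =
          Λ ∩ ball (0 : EuclideanSpace ℝ (Fin 3)) r := by
        ext v
        constructor
        · rintro ⟨hv, hv'⟩
          exact ⟨hv, mem_ball_zero_iff.mpr ((mem_closedBall_zero_iff.mp hv').trans_lt hr'lt)⟩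
        · rintro ⟨hv, hv'⟩
          refine ⟨hv, mem_closedBall_zero_iff.mpr ?_⟩
          exact Finset.le_sup' (fun v => ‖v‖) (hfin.mem_toFinset.mpr ⟨hv, hv'⟩)
      by_cases h1 : 1 ≤ r'
      · -- use the negligibility of clause (vi) at radius `r'`
        have key := hC₁ 0 r' h1
        rw [hset, finsum_mem_eq_finite_toFinset_sum _ hfin] at key
        have hr'le : r' ^ 2 ≤ r ^ 2 := by
          have : 0 ≤ r' := le_trans zero_le_one h1
          nlinarith
        calc ∑ v ∈ hfin.toFinset, A v ≤ C₁ * r' ^ 2 := key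
          _ ≤ max C₁ 0 * r' ^ 2 := by gcongr; exact le_max_left _ _
          _ ≤ max C₁ 0 * r ^ 2 := by gcongr
          _ ≤ (max C₁ 0 + N * max M 0) * r ^ 2 :=
              mul_le_mul_of_nonneg_right (le_add_of_nonneg_right (by positivity)) (sq_nonneg r)
      · -- all vertices lie in the closed unit ball: at most `N` terms, each `≤ max M 0`
        rw [not_le] at h1
        have hsub : hfin.toFinset ⊆ hfin1.toFinset := by
          intro v hv
          have hv' := hfin.mem_toFinset.mp hv
          refine hfin1.mem_toFinset.mpr ⟨hv'.1, mem_closedBall_zero_iff.mpr ?_⟩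
          exact ((Finset.le_sup' (fun v => ‖v‖) hv).trans h1.le)
        calc ∑ v ∈ hfin.toFinset, A v ≤ ∑ v ∈ hfin.toFinset, max M 0 :=
              Finset.sum_le_sum fun v _ => (hAle v).trans (le_max_left _ _)
          _ = hfin.toFinset.card * max M 0 := by rw [Finset.sum_const, nsmul_eq_mul]
          _ ≤ N * max M 0 := by
              gcongr
              exact Finset.card_le_card hsub
          _ ≤ (max C₁ 0 + N * max M 0) * 1 := by
              nlinarith [le_max_right C₁ 0, le_max_right M 0]
          _ ≤ (max C₁ 0 + N * max M 0) * r ^ 2 :=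
              mul_le_mul_of_nonneg_left (by nlinarith) hc0
    · rw [Finset.not_nonempty_iff_eq_empty] at hne
      rw [hne, Finset.sum_empty]
      positivity
  · -- fcc-compatibility from `σ ≤ 8 pt` (Thm. 3.7) and the surplus identity
    intro v _
    have hvol : volume (voronoiCell Λ v) ≠ ⊤ := (volume_voronoiCell_lt_top hsat v).ne
    have key : 4 * √2 - A v =
        (volume (voronoiCell Λ v)).toReal -
          (8 * halesPoint - σ (D Λ v)) / (4 * octahedronDensity) := by
      have := correctedVolume_eq_surplus (σ (D Λ v)) (volume (voronoiCell Λ v)).toReal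
      simp only [hA]
      rw [← sqrt_thirtyTwo]
      linarith
    have hsur : 0 ≤ (8 * halesPoint - σ (D Λ v)) / (4 * octahedronDensity) :=
      div_nonneg (by linarith [hle (D Λ v)]) (by positivity)
    calc ENNReal.ofReal (4 * √2 - A v)
        ≤ ENNReal.ofReal ((volume (voronoiCell Λ v)).toReal) :=
          ENNReal.ofReal_le_ofReal (by rw [key]; linarith)
      _ = volume (voronoiCell Λ v) := ENNReal.ofReal_toReal hvol

/-! ### Stability: Theorems 3.7 and 3.9 read on packings

The following two corollaries are NOT printed in the source as separate statements; they are
derived here from the vendored package by the standard compactness argument: DS is compact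
(§6.1, "Compactness comes from the compactness of the closed ball `B(0, d₀)` …"), `σ` and
`D ↦ U(D)` are continuous (§6.1 topology; Lemma 7.9), so by Thm. 3.7 and Thm. 3.9 a star whose
`U(D)` is not `ε`-matched to the `U` of a maximiser — a Euclidean-motion image of the fcc or hcp
kissing dozen — scores at most `8 pt − κ(ε)` for some `κ(ε) > 0`; the negligible function `A` of
Thm. 3.5, rewritten by `correctedVolume_eq_surplus` as
`A(v) = √32 − vol Ω(v) + (8 pt − σ)/(4 δ_oct)`, then pays `κ(ε)/(4 δ_oct)` for every such vertex
on top of the Voronoi deficit.  The constant in front of `r²` is the printed `C₁` of Thm. 3.5,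
hence quantified per packing; `κ` depends on `ε` only.  Helpers: a gap lemma on compact spaces
and a finite-sum bookkeeping lemma. -/

/-- **A uniform gap below the maximum, off any neighbourhood of the maximisers.**  On a compact
space, a continuous `σ ≤ M` all of whose maximisers have `G` as a neighbourhood satisfies
`σ ≤ M − κ` off `G` for some `κ > 0` (maximise `σ` on the compact complement of the interior of
`G`, where `σ < M`). [folklore] -/
theorem exists_pos_gap_of_nhds_maximisers {X : Type*} [TopologicalSpace X] [CompactSpace X]
    {σ : X → ℝ} {M : ℝ} (hσ : Continuous σ) (hle : ∀ D, σ D ≤ M) {G : Set X}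
    (hG : ∀ D, σ D = M → G ∈ 𝓝 D) : ∃ κ : ℝ, 0 < κ ∧ ∀ D, D ∉ G → σ D ≤ M - κ := by
  have hKc : IsCompact (interior G)ᶜ := isOpen_interior.isClosed_compl.isCompact
  have hsub : ∀ D, D ∉ G → D ∈ (interior G)ᶜ := fun D hD =>
    Set.mem_compl fun hD' => hD (interior_subset hD')
  by_cases hne : ((interior G)ᶜ : Set X).Nonempty
  · obtain ⟨D₁, hD₁K, hD₁⟩ := hKc.exists_isMaxOn hne hσ.continuousOn
    have hlt : σ D₁ < M :=
      lt_of_le_of_ne (hle D₁) fun heq =>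
        absurd (mem_interior_iff_mem_nhds.mpr (hG D₁ heq)) hD₁K
    refine ⟨M - σ D₁, sub_pos.mpr hlt, fun D hD => ?_⟩
    rw [sub_sub_cancel]
    exact (isMaxOn_iff.mp hD₁) D (hsub D hD)
  · exact ⟨1, one_pos, fun D hD => absurd ⟨D, hsub D hD⟩ hne⟩

/-- Bookkeeping for the two corollaries: if `f ≤ a` termwise on a finite set and `f + κ ≤ a` on
the terms satisfying `p`, then `∑ f + κ · #{p} ≤ ∑ a`. [folklore] -/
theorem finsum_add_mul_ncard_le_finsum {ι : Type*} {s : Set ι} (hs : s.Finite) {f a : ι → ℝ}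
    {p : ι → Prop} {κ : ℝ} (h0 : ∀ i ∈ s, f i ≤ a i) (h1 : ∀ i ∈ s, p i → f i + κ ≤ a i) :
    (∑ᶠ i ∈ s, f i) + κ * ({i | i ∈ s ∧ p i}.ncard : ℝ) ≤ ∑ᶠ i ∈ s, a i := by
  classical
  rw [finsum_mem_eq_finite_toFinset_sum _ hs, finsum_mem_eq_finite_toFinset_sum _ hs]
  have hset : {i | i ∈ s ∧ p i} = ↑(hs.toFinset.filter p) := by
    ext i
    simp
  rw [hset, Set.ncard_coe_finset]
  have hcount : κ * ((hs.toFinset.filter p).card : ℝ) =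
      ∑ i ∈ hs.toFinset, (if p i then κ else 0) := by
    rw [Finset.sum_ite, Finset.sum_const_zero, add_zero, Finset.sum_const, nsmul_eq_mul,
      mul_comm]
  rw [hcount, ← Finset.sum_add_distrib]
  refine Finset.sum_le_sum fun i hi => ?_
  have hi' : i ∈ s := hs.mem_toFinset.mp hi
  split_ifs with hp
  · exact h1 i hi' hp
  · rw [add_zero]
    exact h0 i hi'

/-- **Stability of the Hales–Ferguson bound, Voronoi form (corollary of Thms. 3.5, 3.7, 3.9 and
§6.1; not printed as such).**  Assume the vendored package `HalesFerguson_scoreEquality`.  For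
every `ε > 0` there is `κ > 0` such that for every saturated packing `Λ` of unit balls there is
`C` (the printed `C₁` of Thm. 3.5, per packing) with, for all centres `x` and all `r ≥ 1`,
`∑_{v ∈ Λ ∩ B̄(x,r)} (√32 − vol Ω(v)) + κ · #{v ∈ Λ ∩ B̄(x,r) : v is not ε-good} ≤ C r²`,
where `v` is *`ε`-good* when its recentred truncated shell
`{w − v : w ∈ Λ, 0 < |w − v| ≤ 2t₀ = 2.51}` (a finite set `S`) is `ε`-matched
(`EtaMatched ε S P`: a bijection moving each point by at most `ε`) to a finite set `P` that is
the image under a Euclidean motion `g` of `ℝ³` of the fcc or of the hcp kissing dozen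
(`2 • fccKissingPattern`, `2 • hcpKissingPattern`).  Proof: `exists_pos_gap_of_nhds_maximisers`
applied on DS to `G = {D : U(D) is ε-matched to U(D₀) for some maximiser D₀}`, which is a
neighbourhood of every maximiser by clause (i) (§6.1 topology), the maximisers having fcc/hcp
dozens as their `U` by Thm. 3.9; then clause (v) identifies `U(D(v, Λ))` with the shell of `v`,
and clause (vi) (Thm. 3.5) with `correctedVolume_eq_surplus` gives the inequality.
[cite: HalesFerguson2006, §3 Thm. 3.7, Thm. 3.9, Thm. 3.5 with §6.1 (corollary)] -/
theorem stableKepler_voronoi_of_scoreEquality (h : HalesFerguson_scoreEquality) {ε : ℝ}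
    (hε : 0 < ε) :
    ∃ κ : ℝ, 0 < κ ∧ ∀ Λ : Set (EuclideanSpace ℝ (Fin 3)), IsUnitBallPacking Λ → IsSaturated Λ →
      ∃ C : ℝ, ∀ (x : EuclideanSpace ℝ (Fin 3)) (r : ℝ), 1 ≤ r →
        (∑ᶠ v ∈ Λ ∩ closedBall x r, (√32 - (volume (voronoiCell Λ v)).toReal)) +
          κ * ({v | v ∈ Λ ∩ closedBall x r ∧
            ¬ ∃ (S P : Finset (EuclideanSpace ℝ (Fin 3)))
                (g : EuclideanSpace ℝ (Fin 3) ≃ᵢ EuclideanSpace ℝ (Fin 3)),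
              (↑S : Set (EuclideanSpace ℝ (Fin 3))) =
                  (fun w : EuclideanSpace ℝ (Fin 3) => w - v) ''
                    {w | w ∈ Λ ∧ w ≠ v ∧ dist w v ≤ 2.51} ∧
              (g '' ((fun p : EuclideanSpace ℝ (Fin 3) => (2 : ℝ) • p) '' ↑fccKissingPattern) =
                  ↑P ∨
                g '' ((fun p : EuclideanSpace ℝ (Fin 3) => (2 : ℝ) • p) '' ↑hcpKissingPattern) =
                  ↑P) ∧
              EtaMatched ε S P}.ncard : ℝ) ≤ C * r ^ 2 := by
  obtain ⟨X, _, _, _, σ, U, D, hσ, hcont, hle, -, heq, -, hpack⟩ := h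
  -- Thm. 3.9 + §6.1: the `ε`-good stars form a neighbourhood of every maximiser, hence a gap `κ`
  obtain ⟨κ, hκ, hgap⟩ := exists_pos_gap_of_nhds_maximisers hσ hle
    (G := {D' | ∃ D₀ : X, σ D₀ = 8 * halesPoint ∧ EtaMatched ε (U D') (U D₀)})
    fun D₀ hD₀ => by
      filter_upwards [hcont D₀ ε hε] with D' hD'
      exact ⟨D₀, hD₀, hD'⟩
  have hδ := octahedronDensity_pos
  refine ⟨κ / (4 * octahedronDensity), by positivity, fun Λ hΛ hsat => ?_⟩
  obtain ⟨hU, C₁, hC₁⟩ := hpack Λ hΛ hsat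
  refine ⟨C₁, fun x r hr => le_trans ?_ (hC₁ x r hr)⟩
  have hfin : (Λ ∩ closedBall x r).Finite :=
    (finite_inter_ball_of_packing hΛ x (r + 1)).subset
      (inter_subset_inter_right _ (closedBall_subset_ball (by linarith)))
  refine finsum_add_mul_ncard_le_finsum hfin (fun v _ => ?_) (fun v hv hb => ?_)
  · -- every term: `√32 - vol Ω(v) ≤ A(v)` since `σ ≤ 8 pt` (Thm. 3.7)
    have := correctedVolume_eq_surplus (σ (D Λ v)) (volume (voronoiCell Λ v)).toReal
    have hsur : 0 ≤ (8 * halesPoint - σ (D Λ v)) / (4 * octahedronDensity) :=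
      div_nonneg (by linarith [hle (D Λ v)]) (by positivity)
    linarith
  · -- an `ε`-bad vertex: its star is off `G`, so `σ ≤ 8 pt - κ`
    have := correctedVolume_eq_surplus (σ (D Λ v)) (volume (voronoiCell Λ v)).toReal
    have hσv : σ (D Λ v) ≤ 8 * halesPoint - κ := by
      refine hgap (D Λ v) fun hgood => hb ?_
      obtain ⟨D₀, hD₀, hm⟩ := hgood
      obtain ⟨-, g, hg⟩ := heq D₀ hD₀
      exact ⟨U (D Λ v), U D₀, g, hU v hv.1, hg, hm⟩
    have hsur : κ / (4 * octahedronDensity) ≤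
        (8 * halesPoint - σ (D Λ v)) / (4 * octahedronDensity) :=
      div_le_div_of_nonneg_right (by linarith) (by positivity)
    linarith

/-- **Stability of the Hales–Ferguson bound, counting form (corollary; not printed as such).**
Under `HalesFerguson_scoreEquality`: for every `ε > 0` there is `κ > 0` such that every saturated
packing `Λ` of unit balls admits `C` with, for all `x` and all `r ≥ 1`,
`√32 · #(Λ ∩ B̄(x,r)) + κ · #{v ∈ Λ ∩ B̄(x,r) : v is not ε-good} ≤ (4π/3) r³ + C r²`
(`ε`-good as in `stableKepler_voronoi_of_scoreEquality`).  From the Voronoi form: the cells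
`Ω(v)`, `v ∈ Λ ∩ B̄(x,r)`, are almost disjoint and lie in `B(v, 2) ⊆ B(x, r+2)` for a saturated
packing (`voronoiCell_subset_ball`, `volume_biUnion_voronoiCell`), so `∑ vol Ω(v) ≤
(4π/3)(r+2)³ ≤ (4π/3) r³ + 26 (4π/3) r²`.  With `κ = 0` this is Kepler's bound in Hales's
counting form; the `κ`-term is the content of the equality case Thm. 3.9.
[cite: HalesFerguson2006, §3 Thm. 3.7, Thm. 3.9, Thm. 3.5 with §6.1 and Lemma 3.3 (corollary)] -/
theorem stableKepler_counting_of_scoreEquality (h : HalesFerguson_scoreEquality) {ε : ℝ}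
    (hε : 0 < ε) :
    ∃ κ : ℝ, 0 < κ ∧ ∀ Λ : Set (EuclideanSpace ℝ (Fin 3)), IsUnitBallPacking Λ → IsSaturated Λ →
      ∃ C : ℝ, ∀ (x : EuclideanSpace ℝ (Fin 3)) (r : ℝ), 1 ≤ r →
        √32 * ((Λ ∩ closedBall x r).ncard : ℝ) +
          κ * ({v | v ∈ Λ ∩ closedBall x r ∧
            ¬ ∃ (S P : Finset (EuclideanSpace ℝ (Fin 3)))
                (g : EuclideanSpace ℝ (Fin 3) ≃ᵢ EuclideanSpace ℝ (Fin 3)),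
              (↑S : Set (EuclideanSpace ℝ (Fin 3))) =
                  (fun w : EuclideanSpace ℝ (Fin 3) => w - v) ''
                    {w | w ∈ Λ ∧ w ≠ v ∧ dist w v ≤ 2.51} ∧
              (g '' ((fun p : EuclideanSpace ℝ (Fin 3) => (2 : ℝ) • p) '' ↑fccKissingPattern) =
                  ↑P ∨
                g '' ((fun p : EuclideanSpace ℝ (Fin 3) => (2 : ℝ) • p) '' ↑hcpKissingPattern) =
                  ↑P) ∧
              EtaMatched ε S P}.ncard : ℝ) ≤ 4 * π / 3 * r ^ 3 + C * r ^ 2 := by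
  obtain ⟨κ, hκ, hmain⟩ := stableKepler_voronoi_of_scoreEquality h hε
  refine ⟨κ, hκ, fun Λ hΛ hsat => ?_⟩
  obtain ⟨C, hC⟩ := hmain Λ hΛ hsat
  refine ⟨C + 26 * (4 * π / 3), fun x r hr => ?_⟩
  have key := hC x r hr
  have hfin : (Λ ∩ closedBall x r).Finite :=
    (finite_inter_ball_of_packing hΛ x (r + 1)).subset
      (inter_subset_inter_right _ (closedBall_subset_ball (by linarith)))
  -- `∑ vol Ω(v) ≤ vol B(x, r + 2)`
  have hvol : ∑ᶠ v ∈ Λ ∩ closedBall x r, (volume (voronoiCell Λ v)).toReal ≤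
      4 * π / 3 * (r + 2) ^ 3 := by
    rw [finsum_mem_eq_finite_toFinset_sum _ hfin]
    have hSV : ∀ v ∈ hfin.toFinset, v ∈ Λ := fun v hv => (hfin.mem_toFinset.1 hv).1
    have hne : ∀ v ∈ hfin.toFinset, volume (voronoiCell Λ v) ≠ ⊤ := fun v _ =>
      (volume_voronoiCell_lt_top hsat v).ne
    rw [← ENNReal.toReal_sum hne, ← volume_biUnion_voronoiCell hfin.toFinset hSV]
    have hUsub : (⋃ v ∈ hfin.toFinset, voronoiCell Λ v) ⊆ ball x (r + 2) := by
      intro p hp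
      simp only [mem_iUnion, exists_prop] at hp
      obtain ⟨v, hv, hpv⟩ := hp
      have h2 := mem_ball.1 (voronoiCell_subset_ball hsat v hpv)
      have hvx := mem_closedBall.1 (hfin.mem_toFinset.1 hv).2
      rw [mem_ball]
      calc dist p x ≤ dist p v + dist v x := dist_triangle _ _ _
        _ < 2 + r := add_lt_add_of_lt_of_le h2 hvx
        _ = r + 2 := by ring
    have h3 : (0 : ℝ) ≤ r + 2 := by linarith
    calc (volume (⋃ v ∈ hfin.toFinset, voronoiCell Λ v)).toReal
        ≤ (volume (ball x (r + 2))).toReal :=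
          ENNReal.toReal_mono measure_ball_lt_top.ne (measure_mono hUsub)
      _ = 4 * π / 3 * (r + 2) ^ 3 := by
          rw [EuclideanSpace.volume_ball_fin_three, ENNReal.toReal_mul, ← ENNReal.ofReal_pow h3,
            ENNReal.toReal_ofReal (pow_nonneg h3 3), ENNReal.toReal_ofReal (by positivity)]
          ring
  -- `∑ (√32 - vol Ω(v)) = √32 · N - ∑ vol Ω(v)`
  have hsplit : ∑ᶠ v ∈ Λ ∩ closedBall x r, (√32 - (volume (voronoiCell Λ v)).toReal) =
      √32 * ((Λ ∩ closedBall x r).ncard : ℝ) -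
        ∑ᶠ v ∈ Λ ∩ closedBall x r, (volume (voronoiCell Λ v)).toReal := by
    rw [finsum_mem_eq_finite_toFinset_sum _ hfin, finsum_mem_eq_finite_toFinset_sum _ hfin,
      Finset.sum_sub_distrib, Finset.sum_const, nsmul_eq_mul, Set.ncard_eq_toFinset_card _ hfin]
    ring
  have hcube : (r + 2) ^ 3 ≤ r ^ 3 + 26 * r ^ 2 := by nlinarith [hr]
  have hπ : (0 : ℝ) ≤ 4 * π / 3 := by positivity
  have := mul_le_mul_of_nonneg_left hcube hπ
  rw [hsplit] at key
  nlinarith [key, hvol, this]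

end Literature.Geometry.DiscreteGeometry
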